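-- STATUS (stub_arp worker, seat c2, 2026-08-16T16:20Z): target Summits/.../Theorems/ParabolicTrajectoryContinuumLimitOnTrajectoryStubArpC.lean.
-- Expects tree imports: …StubArpA (built), …DefsC (landed, NOT yet built by the farm), Literature…ActionDensityTimeReflection
-- (landed p109879, built), Literature…SchwartzTimeSeparation (landed p110067, built).
-- Compiled in the concatenated scratch ScratchC.lean / ScratchE.lean (rc 0, 0 warnings) with a verbatim excerpt of DefsC
-- (work/stubs/DefsCExcerpt.lean) in place of the unbuilt module. Anchor arpC_cen_curvature_cfgReflect_eq_sum registered.
import Summits.QuantumFields.YangMills.Theorems.ParabolicTrajectoryContinuumLimitOnTrajectoryStubArpA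
import Summits.QuantumFields.YangMills.Theorems.ParabolicTrajectoryContinuumLimitOnTrajectoryDefsC
import Literature.MathematicalPhysics.QuantumFieldTheory.ActionDensityTimeReflection
import Literature.MathematicalPhysics.QuantumLattice.SchwartzTimeSeparation

/-!
# Stub `stub_arp : ARPOfRP` (line `two-orbit-synchronisation`, crux stmt-QuantumFields-10522), part C:
# exact time translation, plaquette strings, the time-chirality of the corner density and its `6^p` expansions

Third helper file of the stub worker for `stub_arp` (seat c2); continues `…StubArpA` (`Arp.lat`, `Arp.cen`). Everything in the
sub-namespace `Arp`.
* `lat_shift` — EXACT TIME TRANSLATION of observables read one step down: if in the slots `i ∈ el` the observable is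
  `V ↦ Wᵢ(configShift e₀ V)`, the lattice functional equals that of `W` against the test function translated by `a_k e₀` in those
  slots (`shiftVec`) — exact (no boundary terms) for test functions vanishing at configurations with a time coordinate of modulus
  `> T`, `T + a_k ≤ a_k L_k`;
* `Vq r sch k q` — the centred single-plaquette species; `canonDistribution_eq_integral_lat` — every canonical string
  distribution of DefsC is the torus expectation of a lattice functional (`rfl`);
* `wilsonTorusMean_curvature`, `cen_curvature_eq_sum` — the centred corner density is the sum of the six centred corner
  plaquettes; `cen_curvature_cfgReflect_eq_sum` — its reflection `(P − ⟨P⟩)∘Θ₀` is the same sum with the three ELECTRIC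
  plaquettes read one step down (`actionDensity_cfgReflect`, the time-chirality of the corner density);
* `lat_curvature_expand`, `lat_curvature_cfgReflect_expand` — the `6^p`-term expansions of the two lattice functionals, the
  reflected one with the electric slots translated by `a_k e₀` in the test function (`shiftTest`);
* `tsupport_Ftil_sub_shiftTest` — the translated conjugated-reflected truncated test functions stay supported at negative,
  pairwise distinct times once `a_k` is below the time gaps (so their tensors with positive-time functions stay in `⁰𝒮`).
-/

set_option autoImplicit false

open scoped SchwartzMap ComplexConjugate
open MeasureTheory Filter Topology
open Literature.MathematicalPhysics.QuantumFieldTheory Literature.MathematicalPhysics.QuantumLattice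
open Literature.MathematicalPhysics.AQFT Literature.Probability.LatticeModels
open Summit.QuantumFields.YangMills.Theses.ParabolicTrajectory

noncomputable section

namespace Summit.QuantumFields.YangMills.Cruxes.ContinuumLimitOnTrajectory.TwoOrbitSynchronisation

local notation "𝔼" => EuclideanSpace ℝ (Fin 4)

/-- (disambiguation: the gauge-configuration translation of `QuantumLattice`, not the spin one of `LatticeModels`) -/
local notation "cfgShift" => Literature.MathematicalPhysics.QuantumLattice.configShift

namespace Arp

section Shift

variable {G : Type} [Group G] [MeasurableSpace G]

/-! ## §B.2 Exact time translation of observables read one step down -/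

/-- The lattice time unit vector `e₀ ∈ ℤ⁴`. -/
abbrev e0 : Site 4 := Pi.single 0 1

/-- The translation vector of `lat_shift`: `−a e₀` in the slots of `el`, `0` elsewhere. -/
def shiftVec {p : ℕ} (el : Finset (Fin p)) (a : ℝ) : Fin p → 𝔼 :=
  fun i => if i ∈ el then -(a • siteToE e0) else 0

/-- The sup norm of the translation vector is at most `a` (`a ≥ 0`). -/
theorem norm_shiftVec_le {p : ℕ} (el : Finset (Fin p)) {a : ℝ} (ha : 0 ≤ a) : ‖shiftVec el a‖ ≤ a := by
  refine (pi_norm_le_iff_of_nonneg ha).2 fun i => ?_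
  unfold shiftVec
  split_ifs
  · rw [norm_neg, norm_smul, Real.norm_of_nonneg ha]
    have h1 : siteToE (d := 4) e0 = EuclideanSpace.single 0 (1 : ℝ) := by
      ext j
      by_cases hj : j = 0
      · subst hj; simp [siteToE_apply]
      · simp [siteToE_apply, hj]
    rw [h1, PiLp.norm_single, norm_one, mul_one]
  · rw [norm_zero]; exact ha

omit [Group G] in
/-- Composition of two lattice translations. -/
theorem configShift_configShift (v w : Site 4) (V : LGConfig 4 G) :
    cfgShift v (cfgShift w V) = cfgShift (v + w) V := by
  funext e
  simp only [Literature.MathematicalPhysics.QuantumLattice.configShift_apply, sub_sub]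

/-- The embedded lattice point of a translated site string: `a (y + χ_el e₀) = a y − shiftVec`. -/
theorem smul_siteToE_add_indicator {p : ℕ} (el : Finset (Fin p)) (a : ℝ) (y : Fin p → Site 4) :
    (fun i => a • siteToE (y i + if i ∈ el then e0 else 0)) =
      (fun i => a • siteToE (y i)) - shiftVec el a := by
  funext i
  simp only [Pi.sub_apply, shiftVec]
  ext j
  split_ifs <;> simp [siteToE_apply, mul_add]

/-- **Exact time translation.** If in the slots `i ∈ el` the observable is read one step down in time
(`V ↦ Wᵢ(configShift e₀ V)`), the lattice functional is that of `W` against the test function translated by `a_k e₀`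
in those slots — provided the test function vanishes whenever some time coordinate has modulus `> T` and
`T + a_k ≤ a_k L_k` (the translated box strings stay in the box: no boundary terms). -/
theorem lat_shift (sch : SpeciesScheme (YMSpecies G)) (k : ℕ) {p : ℕ} (W : Fin p → LGConfig 4 G → ℝ)
    (el : Finset (Fin p)) (F : 𝓢((Fin p → 𝔼), ℂ)) {T : ℝ} (hF : ∀ x, F x ≠ 0 → ∀ i, |x i 0| ≤ T)
    (hT : T + sch.a k ≤ sch.a k * sch.L k) (U : GaugeConfig 4 (sch.side k) G) :
    lat sch k (fun i => if i ∈ el then (fun V => W i (cfgShift e0 V)) else W i) F U =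
      lat sch k W (SchwartzMap.compSubConstCLM ℂ (shiftVec el (sch.a k)) F) U := by
  set a := sch.a k with ha_def
  have ha : 0 < a := sch.a_pos k
  set L := sch.L k with hL_def
  set Ut := torusLift (sch.side k) U
  let v : Fin p → Site 4 := fun i => if i ∈ el then e0 else 0
  -- both sides as sums over site strings
  let f : (Fin p → Site 4) → ℂ := fun y => F (fun i => a • siteToE (y i)) *
    ∏ i, (((if i ∈ el then (fun V => W i (cfgShift e0 V)) else W i) (cfgShift (-(y i)) Ut) : ℝ) : ℂ)
  let g : (Fin p → Site 4) → ℂ := fun y => (SchwartzMap.compSubConstCLM ℂ (shiftVec el a) F)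
    (fun i => a • siteToE (y i)) * ∏ i, ((W i (cfgShift (-(y i)) Ut) : ℝ) : ℂ)
  have hfg : ∀ y, f y = g (y - v) := by
    intro y
    simp only [f, g, SchwartzMap.compSubConstCLM_apply]
    have h1 : (fun i => a • siteToE ((y - v) i)) - shiftVec el a = fun i => a • siteToE (y i) := by
      rw [← smul_siteToE_add_indicator]
      funext i
      simp only [Pi.sub_apply, v, sub_add_cancel]
    rw [h1]
    congr 1
    refine Finset.prod_congr rfl fun i _ => ?_
    by_cases hi : i ∈ el
    · have h2 : -((y - v) i) = e0 + -(y i) := by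
        simp only [Pi.sub_apply, v, hi, ↓reduceIte, neg_sub]
        abel
      simp only [hi, ↓reduceIte, configShift_configShift, h2]
    · simp [hi, v]
  -- time bounds on the support
  have hbox : ∀ y : Fin p → Site 4, F (fun i => a • siteToE (y i)) ≠ 0 →
      ∀ i, -(L : ℤ) + 1 ≤ y i 0 ∧ y i 0 + 1 ≤ L := by
    intro y hy i
    have h := hF _ hy i
    simp only [PiLp.smul_apply, siteToE_apply, smul_eq_mul] at h
    rw [abs_mul, abs_of_pos ha] at h
    have h2 : a * (|(y i 0 : ℝ)| + 1) ≤ a * L := by nlinarith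
    have h3 : |(y i 0 : ℝ)| + 1 ≤ L := le_of_mul_le_mul_left h2 ha
    have h4 : |y i 0| + 1 ≤ (L : ℤ) := by exact_mod_cast h3
    have h5 := le_abs_self (y i 0)
    have h6 := neg_abs_le (y i 0)
    constructor <;> omega
  have hv0 : ∀ i, v i 0 = 0 ∨ v i 0 = 1 := fun i => by by_cases hi : i ∈ el <;> simp [v, hi]
  have hvj : ∀ i j, j ≠ 0 → v i j = 0 := fun i j hj => by by_cases hi : i ∈ el <;> simp [v, hi, hj]
  have hmem : ∀ y : Fin p → Site 4, (∀ i j, j ≠ 0 → -(L : ℤ) ≤ y i j ∧ y i j ≤ L) →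
      (∀ i, -(L : ℤ) ≤ y i 0 ∧ y i 0 ≤ L) → y ∈ Fintype.piFinset (fun _ : Fin p => box 4 L) := by
    intro y h1 h2
    rw [Fintype.mem_piFinset]
    intro i
    rw [mem_box]
    intro j
    by_cases hj : j = 0
    · subst hj; exact h2 i
    · exact h1 i j hj
  unfold lat
  rw [sum_boxFun_eq f, sum_boxFun_eq g]
  refine Finset.sum_bij_ne_zero (fun y _ _ => y - v) (fun y hy hne => ?_)
    (fun y₁ _ _ y₂ _ _ h => sub_left_inj.1 h) (fun z hz hne => ?_) (fun y _ _ => hfg y)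
  · have hb := hbox y (left_ne_zero_of_mul hne)
    rw [Fintype.mem_piFinset] at hy
    refine hmem _ (fun i j hj => ?_) (fun i => ?_)
    · rw [Pi.sub_apply, Pi.sub_apply, hvj i j hj, sub_zero]; exact mem_box.1 (hy i) j
    · have hbi := hb i
      rw [Pi.sub_apply, Pi.sub_apply]
      rcases hv0 i with h | h <;> rw [h] <;> omega
  · have hz' : F (fun i => a • siteToE ((z + v) i)) ≠ 0 := by
      have h := left_ne_zero_of_mul hne
      rw [SchwartzMap.compSubConstCLM_apply, ← smul_siteToE_add_indicator] at h
      exact h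
    refine ⟨z + v, ?_, ?_, add_sub_cancel_right z v⟩
    · have hb := hbox (z + v) hz'
      rw [Fintype.mem_piFinset] at hz
      refine hmem _ (fun i j hj => ?_) (fun i => ?_)
      · rw [Pi.add_apply, Pi.add_apply, hvj i j hj, add_zero]; exact mem_box.1 (hz i) j
      · have hbi := hb i
        rw [Pi.add_apply, Pi.add_apply] at hbi ⊢
        rcases hv0 i with h | h <;> rw [h] at hbi ⊢ <;> omega
    · rw [hfg, add_sub_cancel_right]; exact hne

end Shift

section Plaq

variable {G : Type} [Group G] [TopologicalSpace G] [IsTopologicalGroup G] [CompactSpace G]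
  [MeasurableSpace G] [BorelSpace G]

/-! ## §C.1 Plaquette strings and canonical distributions -/

/-- **The centred single-plaquette species** `plaq r q − ⟨plaq r q⟩_k` as an observable of the infinite lattice. -/
abbrev Vq (r : LatticeRep G) (sch : SpeciesScheme (YMSpecies G)) (k : ℕ) (q : PlaqIdx) : LGConfig 4 G → ℝ :=
  cen r sch k (plaq r q).F

/-- The underlying function of the plaquette species. -/
theorem plaq_F (r : LatticeRep G) (q : PlaqIdx) : (plaq r q).F = plaquetteObs r.ρ 0 q.1.1 q.1.2 := rfl

/-- **Every canonical string distribution is the torus expectation of a lattice functional** (the string of centred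
species against the test function). -/
theorem canonDistribution_eq_integral_lat (r : LatticeRep G) (sch : SpeciesScheme (YMSpecies G)) (k p : ℕ)
    (σ : Fin p → YMSpecies G) (F : 𝓢((Fin p → 𝔼), ℂ)) :
    canonDistribution r sch k p σ F = ∫ U, lat sch k (fun i => cen r sch k (σ i).F) F U ∂(μW r sch k) := rfl

/-! ## §C.2 The centred corner density and its reflection as sums of centred plaquettes -/

/-- A species read on the periodic lift is integrable for the torus Wilson measure (bounded measurable,
probability measure). -/
theorem integrable_species_torusLift (r : LatticeRep G) (sch : SpeciesScheme (YMSpecies G)) (k : ℕ)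
    (s : YMSpecies G) :
    Integrable (fun U : GaugeConfig 4 (2 * sch.L k + 1) G => s.F (torusLift (2 * sch.L k + 1) U))
      (wilsonMeasure (d := 4) (L := 2 * sch.L k + 1) r.ρ (sch.β k)) := by
  haveI := isProbabilityMeasure_wilsonMeasure (d := 4) (L := 2 * sch.L k + 1) r.ρ r.continuous (sch.β k)
  obtain ⟨C, hC⟩ := s.bounded
  exact Integrable.of_bound ((s.measurable.comp (measurable_torusLift _)).aestronglyMeasurable) C
    (Eventually.of_forall fun U => hC _)

/-- **Additivity of the torus mean over the six corner plaquettes**: `⟨P⟩_k = ∑_q ⟨plaq r q⟩_k`. -/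
theorem wilsonTorusMean_curvature (r : LatticeRep G) (sch : SpeciesScheme (YMSpecies G)) (k : ℕ) :
    wilsonTorusMean r.ρ (sch.β k) (sch.L k) r.curvature.F =
      ∑ q : PlaqIdx, wilsonTorusMean r.ρ (sch.β k) (sch.L k) (plaq r q).F := by
  unfold wilsonTorusMean
  rw [← integral_finsetSum _ fun q _ => integrable_species_torusLift r sch k (plaq r q)]
  refine integral_congr_ae (Eventually.of_forall fun U => ?_)
  exact actionDensity_eq_sum_subtype r.ρ _

/-- **The centred corner density is the sum of the six centred corner plaquettes.** -/
theorem cen_curvature_eq_sum (r : LatticeRep G) (sch : SpeciesScheme (YMSpecies G)) (k : ℕ) (V : LGConfig 4 G) :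
    cen r sch k r.curvature.F V = ∑ q : PlaqIdx, Vq r sch k q V := by
  simp only [Vq, cen_apply, wilsonTorusMean_curvature, Finset.sum_sub_distrib, plaq_F]
  exact congrArg (fun z : ℝ => z - _) (actionDensity_eq_sum_subtype r.ρ V)

/-- **The reflected centred plaquette species**: electric plaquettes (`q.1.1 = 0`) read one step down in time,
magnetic ones unchanged. -/
def VqRefl (r : LatticeRep G) (sch : SpeciesScheme (YMSpecies G)) (k : ℕ) (q : PlaqIdx) : LGConfig 4 G → ℝ :=
  fun V => if q.1.1 = 0 then Vq r sch k q (cfgShift e0 V) else Vq r sch k q V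

/-- **Time-chirality of the centred corner density**: read on the reflected field it is the sum of the reflected
centred plaquette species (`actionDensity_cfgReflect`; the centring constant is `Θ₀`-blind). -/
theorem cen_curvature_cfgReflect_eq_sum (r : LatticeRep G) (sch : SpeciesScheme (YMSpecies G)) (k : ℕ)
    (V : LGConfig 4 G) :
    cen r sch k r.curvature.F (cfgReflect V) = ∑ q : PlaqIdx, VqRefl r sch k q V := by
  rw [cen_apply, wilsonTorusMean_curvature, show r.curvature.F (cfgReflect V) = actionDensity r.ρ (cfgReflect V)
    from rfl, actionDensity_cfgReflect r.ρ r.continuous V, ← Finset.sum_sub_distrib]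
  refine Finset.sum_congr rfl fun q _ => ?_
  unfold VqRefl Vq
  split_ifs <;> rfl

/-! ## §C.3 The `6^p` expansions of the curvature lattice functionals -/

/-- The electric slots of a plaquette string. -/
def elSlots {p : ℕ} (q : Fin p → PlaqIdx) : Finset (Fin p) := Finset.univ.filter fun i => (q i).1.1 = 0

/-- The translation of `lat_shift` attached to a plaquette string: by `a_k e₀` in its electric slots. -/
abbrev shiftTest (sch : SpeciesScheme (YMSpecies G)) (k : ℕ) {p : ℕ} (q : Fin p → PlaqIdx)
    (F : 𝓢((Fin p → 𝔼), ℂ)) : 𝓢((Fin p → 𝔼), ℂ) :=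
  SchwartzMap.compSubConstCLM ℂ (shiftVec (elSlots q) (sch.a k)) F

/-- **Expansion of the curvature lattice functional** over plaquette strings. -/
theorem lat_curvature_expand (r : LatticeRep G) (sch : SpeciesScheme (YMSpecies G)) (k : ℕ) {p : ℕ}
    (F : 𝓢((Fin p → 𝔼), ℂ)) (U : GaugeConfig 4 (sch.side k) G) :
    lat sch k (fun _ => cen r sch k r.curvature.F) F U =
      ∑ q : Fin p → PlaqIdx, lat sch k (fun i => Vq r sch k (q i)) F U :=
  lat_expand sch k (fun _ q => Vq r sch k q) (fun _ V => cen_curvature_eq_sum r sch k V) F U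

/-- **Expansion of the REFLECTED curvature lattice functional**: over plaquette strings, with the test function
translated by `a_k e₀` in the electric slots — exact for test functions supported at times of modulus `≤ T`,
`T + a_k ≤ a_k L_k`. -/
theorem lat_curvature_cfgReflect_expand (r : LatticeRep G) (sch : SpeciesScheme (YMSpecies G)) (k : ℕ) {p : ℕ}
    (F : 𝓢((Fin p → 𝔼), ℂ)) {T : ℝ} (hF : ∀ x, F x ≠ 0 → ∀ i, |x i 0| ≤ T) (hT : T + sch.a k ≤ sch.a k * sch.L k)
    (U : GaugeConfig 4 (sch.side k) G) :
    lat sch k (fun _ V => cen r sch k r.curvature.F (cfgReflect V)) F U =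
      ∑ q : Fin p → PlaqIdx, lat sch k (fun i => Vq r sch k (q i)) (shiftTest sch k q F) U := by
  rw [lat_expand sch k (fun _ q => VqRefl r sch k q) (fun _ V => cen_curvature_cfgReflect_eq_sum r sch k V) F U]
  refine Finset.sum_congr rfl fun q _ => ?_
  have hW : (fun i => VqRefl r sch k (q i)) =
      fun i => if i ∈ elSlots q then (fun V => Vq r sch k (q i) (cfgShift e0 V)) else Vq r sch k (q i) := by
    funext i V
    simp only [VqRefl, elSlots, Finset.mem_filter, Finset.mem_univ, true_and]
    split_ifs <;> rfl
  rw [hW]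
  exact lat_shift sch k (fun i => Vq r sch k (q i)) (elSlots q) F hF hT U

/-- Appending two plaquette strings of centred species. -/
theorem append_Vq (r : LatticeRep G) (sch : SpeciesScheme (YMSpecies G)) (k : ℕ) {n m : ℕ}
    (q : Fin n → PlaqIdx) (q' : Fin m → PlaqIdx) :
    Fin.append (fun i => Vq r sch k (q i)) (fun j => Vq r sch k (q' j)) =
      fun i => cen r sch k (plaq r (Fin.append q q' i)).F := by
  funext i
  refine Fin.addCases (fun j => ?_) (fun j => ?_) i
  · simp only [Fin.append_left]
  · simp only [Fin.append_right]

end Plaq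

section Supports

variable {G : Type} [Group G] [MeasurableSpace G]

/-! ## §C.4 Supports of the translated reflected test functions -/

/-- Support of the conjugated reflected truncated test function and of its electric translates: negative, pairwise
distinct times (translation by less than the gap `δ`). -/
theorem tsupport_Ftil_sub_shiftTest (sch : SpeciesScheme (YMSpecies G)) (k : ℕ) {p : ℕ} {F : 𝓢((Fin p → 𝔼), ℂ)}
    {δ T₀ : ℝ} (hsep : tsupport (F : (Fin p → 𝔼) → ℂ) ⊆
      {x | (∀ i, δ ≤ x i 0 ∧ x i 0 ≤ T₀) ∧ ∀ i j, i < j → x i 0 + δ ≤ x j 0})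
    (ha : sch.a k < δ) (q : Fin p → PlaqIdx) :
    tsupport ((starTest (thetaMulti 4 F) - shiftTest sch k q (starTest (thetaMulti 4 F)) : 𝓢((Fin p → 𝔼), ℂ)) :
        (Fin p → 𝔼) → ℂ) ⊆
      {x | (∀ i, x i 0 < 0) ∧ Function.Injective fun i => x i 0} := by
  have ha0 : 0 ≤ sch.a k := (sch.a_pos k).le
  -- both pieces are supported at configurations `x` with `x + c ∈ θ⁻¹(sep)` for a vector `c` with `0 ≤ cᵢ⁰ ≤ a`
  have key : ∀ (c : Fin p → 𝔼), (∀ i, -sch.a k ≤ c i 0 ∧ c i 0 ≤ 0) → ∀ x : Fin p → 𝔼,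
      (fun i => timeReflection 4 ((x - c) i)) ∈ tsupport (F : (Fin p → 𝔼) → ℂ) →
      (∀ i, x i 0 < 0) ∧ Function.Injective fun i => x i 0 := by
    intro c hc x hx
    obtain ⟨h1, h2⟩ := hsep hx
    simp only [timeReflection_apply, if_true, Pi.sub_apply, PiLp.sub_apply, neg_sub] at h1 h2
    have hapos := sch.a_pos k
    refine ⟨fun i => by linarith [(h1 i).1, (hc i).2], fun i j hij => ?_⟩
    by_contra hne
    rcases lt_or_gt_of_ne hne with hlt | hlt
    · have := h2 i j hlt; linarith [(hc i).1, (hc i).2, (hc j).1, (hc j).2, hij.le, hij.ge]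
    · have := h2 j i hlt; linarith [(hc i).1, (hc i).2, (hc j).1, (hc j).2, hij.le, hij.ge]
  have hc0 : ∀ i, -sch.a k ≤ (0 : Fin p → 𝔼) i 0 ∧ (0 : Fin p → 𝔼) i 0 ≤ 0 := fun i => by simp [ha0]
  have hcq : ∀ i, -sch.a k ≤ (shiftVec (elSlots q) (sch.a k)) i 0 ∧ (shiftVec (elSlots q) (sch.a k)) i 0 ≤ 0 := by
    intro i
    simp only [shiftVec]
    split_ifs <;> simp [siteToE_apply, e0, ha0]
  refine (tsupport_sub_subset _ _).trans (Set.union_subset (fun x hx => ?_) (fun x hx => ?_))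
  · refine key 0 hc0 x ?_
    simpa using tsupport_starTest_thetaMulti_subset F hx
  · have h1 := tsupport_compSubConstCLM_subset _ _ hx
    exact key (shiftVec (elSlots q) (sch.a k)) hcq x (tsupport_starTest_thetaMulti_subset F h1)

end Supports

end Arp

/-- **Registered anchor of this file** (closed form of `Arp.cen_curvature_cfgReflect_eq_sum`, for the gate's
`--supports` stub check): the time-chirality of the centred corner density. -/
theorem arpC_cen_curvature_cfgReflect_eq_sum :
    ∀ {G : Type} [Group G] [TopologicalSpace G] [IsTopologicalGroup G] [CompactSpace G]
      [MeasurableSpace G] [BorelSpace G] (r : LatticeRep G) (sch : SpeciesScheme (YMSpecies G)) (k : ℕ)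
      (V : LGConfig 4 G),
      Arp.cen r sch k r.curvature.F (cfgReflect V) = ∑ q : PlaqIdx, Arp.VqRefl r sch k q V := by
  intro G _ _ _ _ _ _ r sch k V
  exact Arp.cen_curvature_cfgReflect_eq_sum r sch k V

end Summit.QuantumFields.YangMills.Cruxes.ContinuumLimitOnTrajectory.TwoOrbitSynchronisation

end
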